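/-
Copyright (c) 2026. All rights reserved.
Released under Apache 2.0 license as described in the file LICENSE.
-/
import Literature.NumberTheory.Automorphic.EichlerOrderRightIdealDuals
import Literature.NumberTheory.Automorphic.BrandtMatrixAtkinLehnerEntries
import HarnessLib

/-!
# The Atkin–Lehner ideals, the codifferent and the discriminant of EVERY Eichler order of level `N⁺` in the definite
# quaternion algebra of discriminant `N⁻`: `𝔔_m(O')² = m O'`, `[O' : 𝔔_m(O')] = m²`, `O'♯ = N⁻¹ 𝔔_N(O')`,
# `disc O' = [O'♯ : O'] = (N⁺N⁻)²`, `I♯ I = O'♯`, `I⁻¹ = 𝔔_N(O') I♯` (Voight 15.6.17, 16.8, 17.4.13, 18.4.7, 23.4.14, 23.4.19, (23.4.20))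

[tag: quaternion_algebra] [tag: eichler_order]

Topic `NumberTheory/Automorphic`; THEOREMS ONLY (no definition, no named fact, no instance, no notation; net debt `0`).
Lane `lit-hodgefound`, seat p12, gen 55 — the genus form of `EichlerOrderAtkinLehnerIdealsExactDivisors.lean`,
`EichlerOrderCodifferent.lean`, `EichlerOrderRightIdealDuals.lean` and `BrandtMatrixAtkinLehnerEntries.lean`: those files are
stated for THE Eichler order `S.O` of a Brandt setup `S : XiSetup N⁺ N⁻`; here the same statements for an ARBITRARY Eichler order
`O'` of level `N⁺` in `S.D` (`Brandt.IsEichlerOrder S.D O' N⁺`). Every such `O'` is the left order `O_L(I)` of a right `S.O`-ideal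
`I` (Voight Lemma 17.4.13: the Eichler orders of level `N⁺` form one genus and are linked to `O` — the tree's
`XiSetup.exists_mem_rightIdeals_leftOrder_eq`), and `(S.D, O_L(I))` is again a Brandt setup of type `(N⁺, N⁻)`
(`XiSetup.ofLeftOrder`), so each statement is a transport along `I`.

THE PRINTED STATEMENTS (Voight, *Quaternion Algebras*, GTM 288). Lemma 17.4.13 / 17.4.3 (orders of the same genus are connected
by an invertible lattice, `O_L(I)` is locally isomorphic to `O_R(I)`); 18.4.7 (`J ↦ I⁻¹ J I` identifies the groups of two-sided
ideals of `O_L(I)` and `O_R(I)`); Prop. 23.4.14 and (23.4.20) (two-sided ideals of an Eichler order: `I² = 𝔭^e O`,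
`0 → Idl(R) → Idl(O) → ∏_{𝔭∣𝔑} ℤ/2ℤ → 0`); 23.4.19 («`𝔑 = 𝔇𝔐` … we call `𝔐` the level», `discrd O = 𝔑`); Lemma 15.6.17
(`disc(O) = [codiff(O) : O]`); 16.8 / Def. 24.2.1 (`diff(O) = codiff(O)⁻¹`, Gorenstein); Cor. 16.8.7 (iii′) (`I⁻¹ = diff(O) I♯`);
Lemma 18.5.1 / Prop. 18.5.3 (a two-sided ideal of reduced norm `m` is principal iff generated by an element of reduced norm `m` of
the normaliser).

For `O'` an Eichler order of level `N⁺` in `S.D`, `N = N⁺N⁻`, `m ∥ N`, `ν = N · 1`, and a bilinear form `T` with `T x y = trd(x y)`: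

* §1 `𝔔_m(O') = O' P_{primes m}(O')`, **`𝔔_m(O') 𝔔_m(O') = m O'`**, `𝔔_{ag}(O') 𝔔_{gb}(O') = g 𝔔_{ab}(O')`,
  **`𝔔_m(O')` principal iff it contains an element of reduced norm `m`**, (23.4.20) `c J = k 𝔔_m(O')` for every two-sided
  `O'`-ideal `J`, with `m` unique, and **`[O' : 𝔔_m(O')] = m²`**;
* §2 the codifferent: `trd(x O') ⊆ ℤ ⟺ N x ∈ 𝔔_N(O')`, **`O'♯ = ν⁻¹ 𝔔_N(O')`**, `N O'♯ = 𝔔_N(O')`, Gorenstein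
  `O'♯ 𝔔_N(O') = O' = 𝔔_N(O') O'♯`, and **`disc O' = [O'♯ : O'] = (N⁺N⁻)²`** — every Eichler order of level `N⁺` in the definite
  quaternion algebra of discriminant `N⁻` has reduced discriminant `N⁺N⁻` (also for the tree's form `trd(x ȳ)`);
* §3 right ideals `I` of `O'` (`I ∈ rightIdeals O'`): `[I : I 𝔔_m(O')] = m²`, `I♯ I = O'♯`, `I I♯ = O_L(I)♯`,
  `I⁻¹ = (O_L(I) : I)_R = 𝔔_N(O') I♯`, `[I♯ : O'♯] = [O' : I]` and `[I♯ : I] = N² [O' : I]²` for `I ⊆ O'`.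

## References

* [Voight2021] J. Voight, *Quaternion Algebras*, GTM 288 (2021): Lemma 15.2.15, Lemma 15.6.17, Cor. 16.7.6, Def. 16.8.1,
  (16.8.4), Cor. 16.8.7, 17.4.3, Lemma 17.4.13, 18.4.7, Lemma 18.5.1, Prop. 18.5.3, Prop. 23.4.14, 23.4.19, (23.4.20),
  Def. 24.2.1, §28.9 (p. 486).
* [VignerasLNM800] M.-F. Vignéras, *Arithmétique des algèbres de quaternions*, LNM 800 (1980), Ch. I §4 Lemme 4.7, Ch. II §2,
  Ch. III §5 (Cor. 5.3, exercice 5.8).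

## Scope (honest)

Theorems only; pure transports of landed statements from `S.O` to every Eichler order of the same level in the same algebra.
-/

noncomputable section

open scoped Pointwise

universe u

namespace Literature.NumberTheory.Automorphic

open AtkinLehner

namespace Brandt

variable {Nplus Nminus : ℕ} (S : XiSetup Nplus Nminus) {O' : Submodule ℤ S.D} (hO' : Brandt.IsEichlerOrder S.D O' Nplus)

include hO'

/-! ## §1 The Atkin–Lehner ideals of every Eichler order of the genus -/

/-- **`𝔔_m(O') = O' P_{primes(m)}(O')` for `m ∥ N⁺N⁻`**, for every Eichler order `O'` of level `N⁺`.
[cite: Voight2021, (23.4.20), Prop. 23.4.14 and Lemma 17.4.13] -/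
theorem XiSetup.atkinLehnerIdeal_eq_order_mul_twoSidedIdealProd_of_isEichlerOrder {m : ℕ} (hm : m ∣ Nplus * Nminus)
    (hcop : m.Coprime (Nplus * Nminus / m)) :
    atkinLehnerIdeal O' m = O' * S.twoSidedIdealProd O' (m.primeFactors.sort (· ≤ ·)) := by
  obtain ⟨I, hI, rfl⟩ := S.exists_mem_rightIdeals_leftOrder_eq S.nplus_ne_zero hO'
  exact S.atkinLehnerIdeal_leftOrder_eq_of_exactDvd hm hcop hI

/-- **`𝔔_m(O') 𝔔_m(O') = m O'` for `m ∥ N⁺N⁻`**, for every Eichler order `O'` of level `N⁺` (Prop. 23.4.14: «the single relation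
`I² = 𝔭^e O`»). [cite: Voight2021, Prop. 23.4.14, (23.4.20) and Lemma 17.4.13] -/
theorem XiSetup.atkinLehnerIdeal_mul_self_of_exactDvd_of_isEichlerOrder {m : ℕ} (hm : m ∣ Nplus * Nminus)
    (hcop : m.Coprime (Nplus * Nminus / m)) :
    atkinLehnerIdeal O' m * atkinLehnerIdeal O' m = (m : ℤ) • O' := by
  obtain ⟨I, hI, rfl⟩ := S.exists_mem_rightIdeals_leftOrder_eq S.nplus_ne_zero hO'
  exact (S.ofLeftOrder hI).atkinLehnerIdeal_mul_self_of_exactDvd hm hcop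

/-- **The Atkin–Lehner relations `𝔔_{ag}(O') 𝔔_{gb}(O') = g 𝔔_{ab}(O')`** (`a, g, b` pairwise coprime, `ag, gb ∥ N⁺N⁻`) for every
Eichler order `O'` of level `N⁺`. [cite: Voight2021, (23.4.20), Prop. 23.4.14 and Example 28.9.10] -/
theorem XiSetup.atkinLehnerIdeal_mul_atkinLehnerIdeal_of_exactDvd_of_isEichlerOrder {a g b : ℕ}
    (hag : a * g ∣ Nplus * Nminus) (hag' : (a * g).Coprime (Nplus * Nminus / (a * g)))
    (hgb : g * b ∣ Nplus * Nminus) (hab : a.Coprime b) (hga : a.Coprime g) (hbg : g.Coprime b) :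
    atkinLehnerIdeal O' (a * g) * atkinLehnerIdeal O' (g * b) = (g : ℤ) • atkinLehnerIdeal O' (a * b) := by
  obtain ⟨I, hI, rfl⟩ := S.exists_mem_rightIdeals_leftOrder_eq S.nplus_ne_zero hO'
  exact (S.ofLeftOrder hI).atkinLehnerIdeal_mul_atkinLehnerIdeal_of_exactDvd hag hag' hgb hab hga hbg

/-- **`𝔔_m(O')` is principal iff it contains an element of reduced norm `m`** (`m ∥ N⁺N⁻`; Lemma 18.5.1), for every Eichler
order `O'` of level `N⁺`. [cite: Voight2021, Lemma 18.5.1, Prop. 18.5.3 and Lemma 17.4.13] -/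
theorem XiSetup.exists_atkinLehnerIdeal_eq_units_smul_iff_of_exactDvd_of_isEichlerOrder {m : ℕ} (hm : m ∣ Nplus * Nminus)
    (hcop : m.Coprime (Nplus * Nminus / m)) :
    (∃ x : S.Dˣ, atkinLehnerIdeal O' m = x • O') ↔ ∃ x ∈ atkinLehnerIdeal O' m, reducedNorm ℚ S.D x = m := by
  obtain ⟨I, hI, rfl⟩ := S.exists_mem_rightIdeals_leftOrder_eq S.nplus_ne_zero hO'
  exact (S.ofLeftOrder hI).exists_atkinLehnerIdeal_eq_units_smul_iff_of_exactDvd hm hcop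

/-- **(23.4.20) in Atkin–Lehner form for every Eichler order `O'` of level `N⁺`**: every two-sided `O'`-ideal `J` satisfies
`c J = k 𝔔_m(O')` for an exact divisor `m ∥ N⁺N⁻` and positive integers `c, k`. [cite: Voight2021, (23.4.20), §28.9 (p. 486) and Lemma 17.4.13] -/
theorem XiSetup.exists_exactDvd_smul_eq_smul_atkinLehnerIdeal_of_isEichlerOrder {J : Submodule ℤ S.D}
    (hJ : J ∈ rightIdeals O') (hJL : leftOrder J = O') :
    ∃ m : ℕ, m ∣ Nplus * Nminus ∧ m.Coprime (Nplus * Nminus / m) ∧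
      ∃ c k : ℕ, c ≠ 0 ∧ k ≠ 0 ∧ (c : ℤ) • J = (k : ℤ) • atkinLehnerIdeal O' m := by
  obtain ⟨I, hI, rfl⟩ := S.exists_mem_rightIdeals_leftOrder_eq S.nplus_ne_zero hO'
  exact (S.ofLeftOrder hI).exists_exactDvd_smul_eq_smul_atkinLehnerIdeal hJ hJL

/-- **Uniqueness of the exact divisor** in `c 𝔔_m(O') = k 𝔔_{m'}(O')`, for every Eichler order `O'` of level `N⁺`.
[cite: Voight2021, (23.4.20), §28.9 (p. 486) and Lemma 17.4.13] -/
theorem XiSetup.eq_of_natCast_smul_atkinLehnerIdeal_eq_of_isEichlerOrder {m m' : ℕ} (hm : m ∣ Nplus * Nminus)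
    (hcop : m.Coprime (Nplus * Nminus / m)) (hm' : m' ∣ Nplus * Nminus) (hcop' : m'.Coprime (Nplus * Nminus / m'))
    {c k : ℕ} (hc : c ≠ 0) (hk : k ≠ 0) (h : (c : ℤ) • atkinLehnerIdeal O' m = (k : ℤ) • atkinLehnerIdeal O' m') :
    m = m' ∧ c = k := by
  obtain ⟨I, hI, rfl⟩ := S.exists_mem_rightIdeals_leftOrder_eq S.nplus_ne_zero hO'
  exact (S.ofLeftOrder hI).eq_of_natCast_smul_atkinLehnerIdeal_eq hm hcop hm' hcop' hc hk h

/-- **`[O' : 𝔔_m(O')] = m²` for `m ∥ N⁺N⁻`**, for every Eichler order `O'` of level `N⁺` (`nrd 𝔔_m = m`).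
[cite: Voight2021, 16.4.10, Prop. 23.4.14 and Lemma 17.4.13] -/
theorem XiSetup.relIndex_atkinLehnerIdeal_of_exactDvd_of_isEichlerOrder {m : ℕ} (hm : m ∣ Nplus * Nminus)
    (hcop : m.Coprime (Nplus * Nminus / m)) :
    (atkinLehnerIdeal O' m).toAddSubgroup.relIndex O'.toAddSubgroup = m ^ 2 := by
  obtain ⟨I, hI, rfl⟩ := S.exists_mem_rightIdeals_leftOrder_eq S.nplus_ne_zero hO'
  exact (S.ofLeftOrder hI).relIndex_atkinLehnerIdeal_of_exactDvd hm hcop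

/-- **`[O' : 𝔔_N(O')] = N²`, `N = N⁺N⁻`** (`nrd(diff O') = discrd O' = N`), for every Eichler order `O'` of level `N⁺`.
[cite: Voight2021, (16.8.4), 23.4.19 and Lemma 17.4.13] -/
theorem XiSetup.relIndex_atkinLehnerIdeal_level_of_isEichlerOrder :
    (atkinLehnerIdeal O' (Nplus * Nminus)).toAddSubgroup.relIndex O'.toAddSubgroup = (Nplus * Nminus) ^ 2 := by
  obtain ⟨I, hI, rfl⟩ := S.exists_mem_rightIdeals_leftOrder_eq S.nplus_ne_zero hO'
  exact (S.ofLeftOrder hI).relIndex_atkinLehnerIdeal_level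

/-! ## §2 The codifferent and the discriminant of every Eichler order of the genus -/

/-- **`trd(x O') ⊆ ℤ ⟺ N x ∈ 𝔔_N(O')`** (`N = N⁺N⁻`): the codifferent of every Eichler order `O'` of level `N⁺` is
`N⁻¹ 𝔔_N(O')`. [cite: Voight2021, Lemma 15.6.17, 23.4.19, (23.4.20) and Lemma 17.4.13] -/
theorem XiSetup.forall_exists_reducedTrace_eq_iff_smul_mem_atkinLehnerIdeal_of_isEichlerOrder (x : S.D) :
    (∀ y ∈ O', ∃ n : ℤ, reducedTrace ℚ S.D (x * y) = n) ↔
      ((Nplus * Nminus : ℕ) : ℤ) • x ∈ atkinLehnerIdeal O' (Nplus * Nminus) := by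
  obtain ⟨I, hI, rfl⟩ := S.exists_mem_rightIdeals_leftOrder_eq S.nplus_ne_zero hO'
  exact (S.ofLeftOrder hI).forall_exists_reducedTrace_eq_iff_smul_mem_atkinLehnerIdeal x

section TraceForm

variable (T : LinearMap.BilinForm ℚ S.D)

/-- **`O'♯ = ν⁻¹ 𝔔_N(O') = codiff(O')`** (`ν = N · 1`) for the form `trd(x y)` and every Eichler order `O'` of level `N⁺`.
[cite: Voight2021, Def. 15.6.15, Lemma 15.6.17, 23.4.19 and Lemma 17.4.13] -/
theorem XiSetup.dualSubmodule_eq_of_isEichlerOrder (hT : ∀ x y, T x y = reducedTrace ℚ S.D (x * y)) {ν : S.Dˣ}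
    (hν : (ν : S.D) = ((Nplus * Nminus : ℕ) : ℤ)) : T.dualSubmodule O' = ν⁻¹ • atkinLehnerIdeal O' (Nplus * Nminus) := by
  obtain ⟨I, hI, rfl⟩ := S.exists_mem_rightIdeals_leftOrder_eq S.nplus_ne_zero hO'
  exact (S.ofLeftOrder hI).dualSubmodule_order_eq T hT hν

/-- **`N · O'♯ = 𝔔_N(O')`** for every Eichler order `O'` of level `N⁺`. [cite: Voight2021, Lemma 15.6.17, (16.8.4), 23.4.19 and Lemma 17.4.13] -/
theorem XiSetup.natCast_smul_dualSubmodule_of_isEichlerOrder (hT : ∀ x y, T x y = reducedTrace ℚ S.D (x * y)) :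
    ((Nplus * Nminus : ℕ) : ℤ) • T.dualSubmodule O' = atkinLehnerIdeal O' (Nplus * Nminus) := by
  obtain ⟨I, hI, rfl⟩ := S.exists_mem_rightIdeals_leftOrder_eq S.nplus_ne_zero hO'
  exact (S.ofLeftOrder hI).natCast_smul_dualSubmodule_order T hT

/-- **Every Eichler order of the genus is Gorenstein: `O'♯ 𝔔_N(O') = O' = 𝔔_N(O') O'♯`** (`diff(O') = codiff(O')⁻¹ = 𝔔_N(O')`).
[cite: Voight2021, Def. 16.8.1, (16.8.4), Def. 24.2.1 and Lemma 17.4.13] -/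
theorem XiSetup.dualSubmodule_mul_atkinLehnerIdeal_level_of_isEichlerOrder (hT : ∀ x y, T x y = reducedTrace ℚ S.D (x * y)) :
    T.dualSubmodule O' * atkinLehnerIdeal O' (Nplus * Nminus) = O' ∧
      atkinLehnerIdeal O' (Nplus * Nminus) * T.dualSubmodule O' = O' := by
  obtain ⟨I, hI, rfl⟩ := S.exists_mem_rightIdeals_leftOrder_eq S.nplus_ne_zero hO'
  exact (S.ofLeftOrder hI).dualSubmodule_order_mul_atkinLehnerIdeal_level T hT

/-- **`O' O'♯ = O'♯ = O'♯ O'`** (Lemma 15.6.16) for every Eichler order `O'` of level `N⁺`. [cite: Voight2021, Lemma 15.6.16 and Lemma 17.4.13] -/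
theorem XiSetup.order_mul_dualSubmodule_of_isEichlerOrder (hT : ∀ x y, T x y = reducedTrace ℚ S.D (x * y)) :
    O' * T.dualSubmodule O' = T.dualSubmodule O' ∧ T.dualSubmodule O' * O' = T.dualSubmodule O' := by
  obtain ⟨I, hI, rfl⟩ := S.exists_mem_rightIdeals_leftOrder_eq S.nplus_ne_zero hO'
  exact (S.ofLeftOrder hI).order_mul_dualSubmodule_order T hT

/-- `O' ⊆ O'♯` for every Eichler order `O'` of level `N⁺`. [cite: Voight2021, Lemma 15.6.16 and Lemma 17.4.13] -/
theorem XiSetup.le_dualSubmodule_of_isEichlerOrder (hT : ∀ x y, T x y = reducedTrace ℚ S.D (x * y)) :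
    O' ≤ T.dualSubmodule O' := by
  obtain ⟨I, hI, rfl⟩ := S.exists_mem_rightIdeals_leftOrder_eq S.nplus_ne_zero hO'
  exact (S.ofLeftOrder hI).order_le_dualSubmodule_order T hT

/-- **`disc(O') = [O'♯ : O'] = (N⁺N⁻)²` for EVERY Eichler order `O'` of level `N⁺`** in the definite quaternion algebra of
discriminant `N⁻` (form `trd(x y)`): the reduced discriminant of an Eichler order of level `N⁺` is `N⁺N⁻` (Voight 23.4.19:
`discrd O = 𝔇𝔐`). [cite: Voight2021, Lemma 15.6.17, 23.4.19 and Lemma 17.4.13] [cite: VignerasLNM800, Ch. III §5 Cor. 5.3] -/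
theorem XiSetup.relIndex_dualSubmodule_of_isEichlerOrder (hT : ∀ x y, T x y = reducedTrace ℚ S.D (x * y)) :
    O'.toAddSubgroup.relIndex (T.dualSubmodule O').toAddSubgroup = (Nplus * Nminus) ^ 2 := by
  obtain ⟨I, hI, rfl⟩ := S.exists_mem_rightIdeals_leftOrder_eq S.nplus_ne_zero hO'
  exact (S.ofLeftOrder hI).relIndex_dualSubmodule_order T hT

/-- **`disc(O') = [O'♯ : O'] = (N⁺N⁻)²` for every Eichler order `O'` of level `N⁺`, for the tree's form `trd(x ȳ)`** (same
dual on orders). [cite: Voight2021, Lemma 15.6.17, 23.4.19 and Lemma 17.4.13] [cite: VignerasLNM800, Ch. III §5 Cor. 5.3] -/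
theorem XiSetup.relIndex_dualSubmodule_conj_of_isEichlerOrder
    (hT : ∀ x y, T x y = reducedTrace ℚ S.D (x * standardInvolution ℚ S.D y)) :
    O'.toAddSubgroup.relIndex (T.dualSubmodule O').toAddSubgroup = (Nplus * Nminus) ^ 2 := by
  obtain ⟨I, hI, rfl⟩ := S.exists_mem_rightIdeals_leftOrder_eq S.nplus_ne_zero hO'
  exact (S.ofLeftOrder hI).relIndex_dualSubmodule T hT

/-- **`O'♯ = ν⁻¹ 𝔔_N(O')` for the tree's form `trd(x ȳ)`** and every Eichler order `O'` of level `N⁺`.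
[cite: Voight2021, Lemma 15.6.17, 23.4.19 and Lemma 17.4.13] -/
theorem XiSetup.dualSubmodule_conj_eq_of_isEichlerOrder
    (hT : ∀ x y, T x y = reducedTrace ℚ S.D (x * standardInvolution ℚ S.D y)) {ν : S.Dˣ}
    (hν : (ν : S.D) = ((Nplus * Nminus : ℕ) : ℤ)) : T.dualSubmodule O' = ν⁻¹ • atkinLehnerIdeal O' (Nplus * Nminus) := by
  obtain ⟨I, hI, rfl⟩ := S.exists_mem_rightIdeals_leftOrder_eq S.nplus_ne_zero hO'
  exact (S.ofLeftOrder hI).dualSubmodule_eq_units_inv_smul_atkinLehnerIdeal T hT hν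

/-! ## §3 Right ideals of every Eichler order of the genus -/

/-- **`[I : I 𝔔_m(O')] = m²`** for every right `O'`-ideal `I` and `m ∥ N⁺N⁻` (`O'` any Eichler order of level `N⁺`).
[cite: Voight2021, 16.4.10, Prop. 23.4.14, (41.1.1) and Lemma 17.4.13] -/
theorem XiSetup.relIndex_mul_atkinLehnerIdeal_of_exactDvd_of_isEichlerOrder {m : ℕ} (hm : m ∣ Nplus * Nminus)
    (hcop : m.Coprime (Nplus * Nminus / m)) {I : Submodule ℤ S.D} (hI' : I ∈ rightIdeals O') :
    (I * atkinLehnerIdeal O' m).toAddSubgroup.relIndex I.toAddSubgroup = m ^ 2 := by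
  obtain ⟨J, hJ, rfl⟩ := S.exists_mem_rightIdeals_leftOrder_eq S.nplus_ne_zero hO'
  exact (S.ofLeftOrder hJ).relIndex_mul_atkinLehnerIdeal_of_exactDvd hm hcop hI'

/-- **`I 𝔔_m(O') 𝔔_m(O') = m I`** for every right `O'`-ideal `I` and `m ∥ N⁺N⁻`. [cite: Voight2021, Prop. 23.4.14, Lemma 18.5.1 and Lemma 17.4.13] -/
theorem XiSetup.mul_atkinLehnerIdeal_mul_atkinLehnerIdeal_of_exactDvd_of_isEichlerOrder {m : ℕ} (hm : m ∣ Nplus * Nminus)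
    (hcop : m.Coprime (Nplus * Nminus / m)) {I : Submodule ℤ S.D} (hI' : I ∈ rightIdeals O') :
    I * atkinLehnerIdeal O' m * atkinLehnerIdeal O' m = (m : ℤ) • I := by
  obtain ⟨J, hJ, rfl⟩ := S.exists_mem_rightIdeals_leftOrder_eq S.nplus_ne_zero hO'
  exact (S.ofLeftOrder hJ).mul_atkinLehnerIdeal_mul_atkinLehnerIdeal_of_exactDvd hm hcop hI'

/-- **`I♯ I = O'♯`** for every right `O'`-ideal `I` (`O'` any Eichler order of level `N⁺`; Cor. 15.6.13 / proof of Prop. 16.8.5).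
[cite: Voight2021, Cor. 15.6.13, Prop. 16.8.5 (proof) and Lemma 17.4.13] -/
theorem XiSetup.dualSubmodule_mul_self_of_isEichlerOrder (hT : ∀ x y, T x y = reducedTrace ℚ S.D (x * y))
    {I : Submodule ℤ S.D} (hI' : I ∈ rightIdeals O') : T.dualSubmodule I * I = T.dualSubmodule O' := by
  obtain ⟨J, hJ, rfl⟩ := S.exists_mem_rightIdeals_leftOrder_eq S.nplus_ne_zero hO'
  exact (S.ofLeftOrder hJ).dualSubmodule_mul_self T hT hI'

/-- **`I I♯ = O_L(I)♯`** for every right `O'`-ideal `I` (`O'` any Eichler order of level `N⁺`). [cite: Voight2021, Prop. 16.8.5 (proof), Cor. 15.6.13 and Lemma 17.4.13] -/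
theorem XiSetup.self_mul_dualSubmodule_of_isEichlerOrder (hT : ∀ x y, T x y = reducedTrace ℚ S.D (x * y))
    {I : Submodule ℤ S.D} (hI' : I ∈ rightIdeals O') : I * T.dualSubmodule I = T.dualSubmodule (leftOrder I) := by
  obtain ⟨J, hJ, rfl⟩ := S.exists_mem_rightIdeals_leftOrder_eq S.nplus_ne_zero hO'
  exact (S.ofLeftOrder hJ).self_mul_dualSubmodule T hT hI'

/-- **Cor. 16.8.7 (iii′) for every Eichler order of the genus: `I⁻¹ = (O_L(I) : I)_R = 𝔔_N(O') I♯`** for every right `O'`-ideal `I`.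
[cite: Voight2021, Cor. 16.8.7 (iii′), Cor. 16.7.6 and Lemma 17.4.13] -/
theorem XiSetup.transporterRight_leftOrder_eq_of_isEichlerOrder (hT : ∀ x y, T x y = reducedTrace ℚ S.D (x * y))
    {I : Submodule ℤ S.D} (hI' : I ∈ rightIdeals O') :
    transporterRight I (leftOrder I) = atkinLehnerIdeal O' (Nplus * Nminus) * T.dualSubmodule I := by
  obtain ⟨J, hJ, rfl⟩ := S.exists_mem_rightIdeals_leftOrder_eq S.nplus_ne_zero hO'
  exact (S.ofLeftOrder hJ).transporterRight_leftOrder_eq T hT hI'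

/-- `I (𝔔_N(O') I♯) = O_L(I)` and `(𝔔_N(O') I♯) I = O'`: `𝔔_N(O') I♯` is the two-sided inverse of the right `O'`-ideal `I`.
[cite: Voight2021, Cor. 16.8.7 (iii′), (16.8.6) and Lemma 17.4.13] -/
theorem XiSetup.mul_atkinLehnerIdeal_mul_dualSubmodule_of_isEichlerOrder (hT : ∀ x y, T x y = reducedTrace ℚ S.D (x * y))
    {I : Submodule ℤ S.D} (hI' : I ∈ rightIdeals O') :
    I * (atkinLehnerIdeal O' (Nplus * Nminus) * T.dualSubmodule I) = leftOrder I ∧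
      atkinLehnerIdeal O' (Nplus * Nminus) * T.dualSubmodule I * I = O' := by
  obtain ⟨J, hJ, rfl⟩ := S.exists_mem_rightIdeals_leftOrder_eq S.nplus_ne_zero hO'
  exact ⟨(S.ofLeftOrder hJ).self_mul_atkinLehnerIdeal_mul_dualSubmodule T hT hI',
    (S.ofLeftOrder hJ).atkinLehnerIdeal_mul_dualSubmodule_mul_self T hT hI'⟩

/-- **`O_L(I♯) = O'` and `O_R(I♯) = O_L(I)`** for every right `O'`-ideal `I` (Prop. 15.6.6). [cite: Voight2021, Prop. 15.6.6 and Lemma 17.4.13] -/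
theorem XiSetup.leftOrder_dualSubmodule_of_isEichlerOrder (hT : ∀ x y, T x y = reducedTrace ℚ S.D (x * y))
    {I : Submodule ℤ S.D} (hI' : I ∈ rightIdeals O') :
    leftOrder (T.dualSubmodule I) = O' ∧ rightOrder (T.dualSubmodule I) = leftOrder I := by
  obtain ⟨J, hJ, rfl⟩ := S.exists_mem_rightIdeals_leftOrder_eq S.nplus_ne_zero hO'
  exact ⟨(S.ofLeftOrder hJ).leftOrder_dualSubmodule T hT hI', (S.ofLeftOrder hJ).rightOrder_dualSubmodule T hT hI'⟩

/-- **`[I♯ : O'♯] = [O' : I]` and `[I♯ : I] = (N⁺N⁻)² [O' : I]²`** for every right `O'`-ideal `I ⊆ O'` (`disc(I) = [O' : I]² disc(O')`,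
Lemma 15.2.15). [cite: Voight2021, Lemma 15.2.15, Lemma 15.6.17 and Lemma 17.4.13] -/
theorem XiSetup.relIndex_dualSubmodule_dualSubmodule_of_isEichlerOrder (hT : ∀ x y, T x y = reducedTrace ℚ S.D (x * y))
    {I : Submodule ℤ S.D} (hI' : I ∈ rightIdeals O') (hIO : I ≤ O') :
    (T.dualSubmodule O').toAddSubgroup.relIndex (T.dualSubmodule I).toAddSubgroup = I.toAddSubgroup.relIndex O'.toAddSubgroup ∧
      I.toAddSubgroup.relIndex (T.dualSubmodule I).toAddSubgroup =
        (Nplus * Nminus) ^ 2 * (I.toAddSubgroup.relIndex O'.toAddSubgroup) ^ 2 := by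
  obtain ⟨J, hJ, rfl⟩ := S.exists_mem_rightIdeals_leftOrder_eq S.nplus_ne_zero hO'
  exact ⟨(S.ofLeftOrder hJ).relIndex_dualSubmodule_order_dualSubmodule T hT hI' hIO,
    (S.ofLeftOrder hJ).relIndex_self_dualSubmodule T hT hI' hIO⟩

end TraceForm

end Brandt

end Literature.NumberTheory.Automorphic
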